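import Literature.MathematicalPhysics.QuantumFieldTheory.OSTemperednessPoly
import HarnessLib

/-!
# Osterwalder–Schrader II, Theorem 4.1: the temperedness estimate (4.5)

Topic `Literature/MathematicalPhysics/QuantumFieldTheory`; paper-keyed story for
Osterwalder–Schrader, *Axioms for Euclidean Green's functions II* (Comm. Math. Phys. 42 (1975)),
Theorem 4.1, second half. The first half — the Schwinger distributions of a family with E0'
(linear growth), E1 (Euclidean covariance) and E2 (reflection positivity) have real-analytic
densities `S_{k+2}` on the time-ordered region — is
`OSPointwiseAnalyticity.schwinger_exists_realAnalytic_density`. Here the densities are shown to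
obey the **temperedness estimate (4.5)**: there are `C` and `N` with

`|S_{k+2}(x)| ≤ C (1 + ‖x‖)ᴺ (1 + (min_i (x⁰_{i+1} − x⁰_i))⁻¹)ᴺ`

on the ordered region (`schwinger_exists_realAnalytic_density_tempered`). The proof is the
explicit form of the proof of the first half: the explicit skeleton data of OS II Ch. V.1
(`OSQuantSkeletonData`), the explicit density of the skeleton distribution with a free Gaussian
window (`OSRegularisedDensityWindow`), the explicit base index and Jacobian
(`OSBaseIndex`, `OSFrameBounds`), the resulting closed-form bound `qsF` of the density at the
centre (`OSTemperednessPieces`) with the window `b = (1 + Λ)⁻¹` adapted to the logarithmic radius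
`Λ` of the gap, and its polynomial domination (`OSTemperednessPoly`); the local densities are
finally identified with the global one by continuity (`eqOn_of_forall_integral_mul_eq`).

## References

* K. Osterwalder, R. Schrader, *Axioms for Euclidean Green's functions II*, Comm. Math. Phys.
  42 (1975) 281–305, Thm. 4.1 (4.4)–(4.5), Ch. V, Ch. VI.1. [OsterwalderSchraderCMP1975]
-/

noncomputable section

open MeasureTheory Set Filter Module Metric
open _root_.Topology
open scoped InnerProductSpace RealInnerProductSpace SchwartzMap

namespace Literature.MathematicalPhysics.QuantumFieldTheory

open Literature.MathematicalPhysics.QuantumLattice (SchwingerFamily IsPositiveTimeMulti schwartzNorm)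
open Literature.MathematicalPhysics.QuantumLattice.SchwingerFamily
open Literature.MathematicalPhysics.QuantumLattice.SchwingerFamily.OSSpace
open Literature.Analysis.Distribution
open Literature.Analysis.Complex

variable {d : ℕ} [NeZero d] {k : ℕ}

/-- **Osterwalder–Schrader II, Theorem 4.1 with the temperedness estimate (4.5).** For a Schwinger
family with E0' (linear growth), E1 and E2, the distribution `𝔖_{k+2}` has on the time-ordered
region `{x⁰_0 < x⁰_1 < ⋯ < x⁰_{k+1}}` a density `S` which is continuous, locally the restriction to
real points of a holomorphic function (hence real analytic), represents `𝔖_{k+2}` on the test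
functions supported in the region, and obeys, for some constants `C` and `N`,
`‖S(x)‖ ≤ C (1 + ‖x‖)ᴺ (1 + (minGap x)⁻¹)ᴺ` with `minGap x = min_i (x⁰_{i+1} − x⁰_i)`. [cite: OsterwalderSchraderCMP1975, Thm. 4.1 (4.4)–(4.5)] -/
theorem schwinger_exists_realAnalytic_density_tempered (𝔖 : SchwingerFamily (EuclideanSpace ℝ (Fin d)))
    (hE1 : 𝔖.IsEuclideanCovariant) (hE2 : 𝔖.IsOSReflectionPositive) (hE0 : 𝔖.HasLinearGrowth) :
    ∃ S : (Fin (k + 2) → EuclideanSpace ℝ (Fin d)) → ℂ, ContinuousOn S (orderedRegion k d) ∧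
      (∀ x ∈ orderedRegion k d, ∃ ρ : ℝ, 0 < ρ ∧ Metric.ball x ρ ⊆ orderedRegion k d ∧
        ∃ Sc : (Fin (k + 2) → Fin d → ℂ) → ℂ, DifferentiableOn ℂ Sc (ball (cfgPt x) ρ) ∧
          (∀ y ∈ Metric.ball x ρ, Sc (cfgPt y) = S y) ∧
          ∀ F : 𝓢((Fin (k + 2) → EuclideanSpace ℝ (Fin d)), ℂ),
            tsupport (F : (Fin (k + 2) → EuclideanSpace ℝ (Fin d)) → ℂ) ⊆ Metric.ball x ρ →
              𝔖 (k + 2) F = ∫ y, S y * F y) ∧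
      ∃ C : ℝ, ∃ N : ℕ, 0 ≤ C ∧ ∀ x ∈ orderedRegion k d,
        ‖S x‖ ≤ C * (1 + ‖x‖) ^ N * (1 + (minGap x)⁻¹) ^ N := by
  obtain ⟨S, hSc, hloc⟩ := schwinger_exists_realAnalytic_density (k := k) 𝔖 hE1 hE2 hE0
  -- the E0' and temperedness data
  obtain ⟨s, Cv, hCv, hv⟩ := exists_norm_ι_δ_le_of_hasLinearGrowth 𝔖 hE2 hE0
  obtain ⟨s', σ, α', β', -, hσ⟩ := hE0
  have hσ' : ∀ F : 𝓢((Fin (k + 2) → EuclideanSpace ℝ (Fin d)), ℂ),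
      ‖𝔖 (k + 2) F‖ ≤ |σ (k + 2)| * schwartzNorm ((k + 2) * s') F := fun F =>
    (hσ (k + 2) F).trans (mul_le_mul_of_nonneg_right (le_abs_self _) (QuantumLattice.schwartzNorm_nonneg _ _))
  have hC₀ : 0 ≤ |σ (k + 2)| := abs_nonneg _
  have hM : (k + 1 + (k + 1)) * s ≤ (k + 1 + (k + 1)) * s := le_rfl
  -- the polynomial domination of the explicit bound
  obtain ⟨C, N, hC, hF⟩ := polyDom_qsF (k := k) (d := d) hCv ((k + 1 + (k + 1)) * s)
  refine ⟨S, hSc, hloc, C, N, hC, fun x hx => ?_⟩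
  -- the local density with the explicit bound at the centre
  obtain ⟨ρ₁, hρ₁, S₁, hS₁, -, hrep₁, hcentre⟩ := schwinger_density_centre_le 𝔖 hE1 hE2 hCv hv hM hC₀ hσ' x hx
  obtain ⟨ρ₂, hρ₂, hball₂, Sc, -, hScS, hrep₂⟩ := hloc x hx
  -- the two densities agree near `x`
  set U : Set (Fin (k + 2) → EuclideanSpace ℝ (Fin d)) := Metric.ball x (min ρ₁ ρ₂) with hU
  have hU1 : U ⊆ Metric.ball x ρ₁ := Metric.ball_subset_ball (min_le_left _ _)
  have hU2 : U ⊆ Metric.ball x ρ₂ := Metric.ball_subset_ball (min_le_right _ _)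
  have hf : ContinuousOn S U := hSc.mono (hU2.trans hball₂)
  have hg : ContinuousOn (fun y => S₁ (cfgPt y)) U :=
    hS₁.continuousOn.comp continuous_cfgPt.continuousOn fun y hy => cfgPt_mem_ball (hU1 hy)
  have heq : EqOn S (fun y => S₁ (cfgPt y)) U :=
    eqOn_of_forall_integral_mul_eq isOpen_ball hf hg fun F hF _ => by rw [← hrep₂ F (hF.trans hU2), hrep₁ F (hF.trans hU1)]
  have hx0 : x ∈ U := mem_ball_self (lt_min hρ₁ hρ₂)
  rw [heq hx0]
  exact hcentre.trans ((le_abs_self _).trans (hF x hx))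

end Literature.MathematicalPhysics.QuantumFieldTheory
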